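import Summits.KontsevichZagierPeriods.KontsevichZagierPeriods.Theorems.SymplecticScissorsRealOnePeriodRelationsLogLoopLayerModels
import Summits.KontsevichZagierPeriods.KontsevichZagierPeriods.Theorems.SymplecticScissorsRealOnePeriodRelationsStubQuarticOvalCell
import Summits.KontsevichZagierPeriods.KontsevichZagierPeriods.Theorems.SymplecticScissorsRealOnePeriodRelationsStubQuarticLattice

/-!
# `RealOnePeriodRelations` (stmt-KontsevichZagierPeriods-10042), line `nash-retraction-thin-strip`, reshape 7b:
# the QUARTIC-OVAL layer of the crux, unconditionally

A complete first-kind integral `∫_{ε₁}^{ε₂} c₀ dx/√q` over a real oval of a separable quartic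
`q = a₄x⁴ + a₃x³ + a₂x² + a₁x + a₀` over `ℚ̄ ∩ ℝ` (`ε₁ < ε₂` consecutive real roots, `q > 0` between them, `q′(ε₁) > 0`) is ONE
instance of Kontsevich–Zagier's rule (2) — the Möbius chart `v = q′(ε₁)/(x − ε₁)` — away from a COMPLETE branch integral
`∫ c₀ dv/√D` of the monic resolvent cubic `D(v) = v³ + c₂v² + c₁c₃v + a₄c₃²` (`c₃ = q′(ε₁)`, `c₂ = q″(ε₁)/2`, `c₁ = q‴(ε₁)/6`;
identity `q(ε₁ + c₃/v)·v⁴ = c₃²·D(v)`): the landed stub `QuarticLayer.stub_quarticOvalCell` (p141502).  The depressed form of `D`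
is a non-singular Weierstrass cubic with a lattice (`QuarticLayer.stub_quarticLattice`, p141384, uniformization), so the landed
CUBIC LOOP LAYER `LogLoopLayer.realOnePeriodRelations_ratCubicLayer` (Huber–Wüstholz 13.3 (2) for closed paths on any finite family
of elliptic curves over `ℚ̄`, CM and isogenies allowed, together with Baker's theorem for the rational representations) applies:

* `realOnePeriodRelations_ratQuarticOvalLayer` — every `ℤ`-combination with vanishing value of rational representations,
  polynomial cells and complete first-kind oval integrals of finitely many separable real quartics over `ℚ̄ ∩ ℝ` lies in
  `M₁ = closure (1a ∪ 1b ∪ 2 ∪ Green)` — unconditionally.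

References: A. Huber, G. Wüstholz, *Transcendence and Linear Relations of 1-Periods* (CUP 2022), Thm 13.3 (2), Thm 15.3 (1);
M. Kontsevich, D. Zagier, *Periods* (2001), §1.2 (rule 2).
-/

noncomputable section

open scoped BigOperators Polynomial
open Set MeasureTheory
open Literature.NumberTheory.Transcendental
open Summit.KontsevichZagierPeriods.SymplecticScissors.RealOnePeriodRelationsNegative (M₁ H₁)

namespace Summit.KontsevichZagierPeriods.SymplecticScissors.RealOnePeriodRelations

namespace QuarticLayer

/-- **THE QUARTIC-OVAL LAYER OF THE CRUX, UNCONDITIONALLY, WITH THE RATIONAL REPRESENTATIONS.**  Let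
`q_j = a₄x⁴ + a₃x³ + a₂x² + a₁x + a₀` (`j < n`) be separable quartics over `ℚ̄ ∩ ℝ` (`a₄ ≠ 0`) with marked real roots `ε_j`,
`q_j′(ε_j) > 0`.  Every `ℤ`-combination with vanishing value of rational representations (`π`, logarithms of rationals, …),
polynomial cells and COMPLETE first-kind oval integrals `∫_{ε_j}^{ε₂} c₀ dx/√q_j` (`ε₂` the next real root, `q_j > 0` between, `c₀`
real algebraic) lies in `M₁ = closure (1a ∪ 1b ∪ 2 ∪ Green)`.  Proof: one Möbius move per oval (`stub_quarticOvalCell`) onto a complete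
branch integral of the monic resolvent cubic `D_j`, a lattice for its depressed form (`stub_quarticLattice`), and the landed
`LogLoopLayer.realOnePeriodRelations_ratCubicLayer` (CM and isogenies allowed: closed paths).
[cite: HuberWustholz2022, Thm 13.3 (2), Thm 15.3 (1)] [cite: KontsevichZagier2001, §1.2 (rule 2)] -/
theorem realOnePeriodRelations_ratQuarticOvalLayer : ∀ (n : ℕ) (a₄ a₃ a₂ a₁ a₀ ε : Fin n → ℝ),
    (∀ j, IsAlgebraic ℚ (a₄ j)) → (∀ j, IsAlgebraic ℚ (a₃ j)) → (∀ j, IsAlgebraic ℚ (a₂ j)) →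
    (∀ j, IsAlgebraic ℚ (a₁ j)) → (∀ j, IsAlgebraic ℚ (a₀ j)) → (∀ j, IsAlgebraic ℚ (ε j)) → (∀ j, a₄ j ≠ 0) →
    (∀ j, ∀ x : ℂ, (a₄ j : ℂ) * x ^ 4 + a₃ j * x ^ 3 + a₂ j * x ^ 2 + a₁ j * x + a₀ j = 0 →
      4 * (a₄ j : ℂ) * x ^ 3 + 3 * a₃ j * x ^ 2 + 2 * a₂ j * x + a₁ j ≠ 0) →
    (∀ j, a₄ j * ε j ^ 4 + a₃ j * ε j ^ 3 + a₂ j * ε j ^ 2 + a₁ j * ε j + a₀ j = 0) →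
    (∀ j, 0 < 4 * a₄ j * ε j ^ 3 + 3 * a₃ j * ε j ^ 2 + 2 * a₂ j * ε j + a₁ j) →
    ∀ c : KZ.FormalRep, c ∈ AddSubgroup.closure ((fun r : KZ.IntegralRep 1 => KZ.of r) ''
      {r | r.IsRational ∨ (∃ a b : ℝ, IsAlgebraic ℚ a ∧ IsAlgebraic ℚ b ∧ a < b ∧ r.domain = {z | z 0 ∈ Set.Ioo a b} ∧
            ∃ P : Polynomial (algebraicClosure ℚ ℝ), ∀ x ∈ Set.Ioo a b, r.integrand (fun _ => x) = Polynomial.aeval x P) ∨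
        (∃ j, ∃ ε₂ c₀ : ℝ, IsAlgebraic ℚ ε₂ ∧ IsAlgebraic ℚ c₀ ∧ ε j < ε₂ ∧
          a₄ j * ε₂ ^ 4 + a₃ j * ε₂ ^ 3 + a₂ j * ε₂ ^ 2 + a₁ j * ε₂ + a₀ j = 0 ∧
          (∀ x ∈ Set.Ioo (ε j) ε₂, 0 < a₄ j * x ^ 4 + a₃ j * x ^ 3 + a₂ j * x ^ 2 + a₁ j * x + a₀ j) ∧
          r.domain = {z | z 0 ∈ Set.Ioo (ε j) ε₂} ∧
          ∀ z ∈ r.domain, r.integrand z =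
            c₀ / Real.sqrt (a₄ j * (z 0) ^ 4 + a₃ j * (z 0) ^ 3 + a₂ j * (z 0) ^ 2 + a₁ j * (z 0) + a₀ j))}) →
    KZ.eval c = 0 →
    c ∈ AddSubgroup.closure (KZ.domainAddRel ∪ KZ.integrandAddRel ∪ KZ.changeOfVariablesRel ∪
      {g : KZ.FormalRep | ∃ (Δ : Set (Fin 2 → ℝ)) (A B S : (Fin 2 → ℝ) → ℝ) (r₀₁ r₁₂ r₀₂ : KZ.IntegralRep 1),
        Δ = {p | 0 ≤ p 0 ∧ 0 ≤ p 1 ∧ p 0 + p 1 ≤ 1} ∧ IsSemialgebraicFunOn ℚ Δ A ∧ IsSemialgebraicFunOn ℚ Δ B ∧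
        ContinuousOn A Δ ∧ ContinuousOn B Δ ∧
        (∀ p : Fin 2 → ℝ, 0 < p 0 → 0 < p 1 → p 0 + p 1 < 1 →
          HasFDerivAt S (A p • ContinuousLinearMap.proj (R := ℝ) (φ := fun _ : Fin 2 => ℝ) 0 +
            B p • ContinuousLinearMap.proj (R := ℝ) (φ := fun _ : Fin 2 => ℝ) 1) p) ∧
        r₀₁.domain = {z | z 0 ∈ Set.Ioo 0 1} ∧ r₁₂.domain = {z | z 0 ∈ Set.Ioo 0 1} ∧
        r₀₂.domain = {z | z 0 ∈ Set.Ioo 0 1} ∧ (∀ z ∈ r₀₁.domain, r₀₁.integrand z = A ![z 0, 0]) ∧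
        (∀ z ∈ r₁₂.domain, r₁₂.integrand z = B ![1 - z 0, z 0] - A ![1 - z 0, z 0]) ∧
        (∀ z ∈ r₀₂.domain, r₀₂.integrand z = B ![0, z 0]) ∧ g = KZ.of r₀₁ + KZ.of r₁₂ - KZ.of r₀₂}) := by
  intro n a₄ a₃ a₂ a₁ a₀ ε ha₄ ha₃ ha₂ ha₁ ha₀ hε ha₄0 hsep hroot hder c hc heval
  change c ∈ M₁
  -- Taylor coefficients of `q_j` at `ε_j` and the monic resolvent cubic `D_j = v³ + b₂ v² + b₁ v + b₀`
  set c₃ : Fin n → ℝ := fun j => 4 * a₄ j * ε j ^ 3 + 3 * a₃ j * ε j ^ 2 + 2 * a₂ j * ε j + a₁ j with hc₃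
  set b₂ : Fin n → ℝ := fun j => 6 * a₄ j * ε j ^ 2 + 3 * a₃ j * ε j + a₂ j with hb₂
  set b₁ : Fin n → ℝ := fun j => (4 * a₄ j * ε j + a₃ j) * c₃ j with hb₁
  set b₀ : Fin n → ℝ := fun j => a₄ j * c₃ j ^ 2 with hb₀
  have hc₃alg : ∀ j, IsAlgebraic ℚ (c₃ j) := fun j =>
    (((((isAlgebraic_nat 4).mul (ha₄ j)).mul ((hε j).pow 3)).add
      (((isAlgebraic_nat 3).mul (ha₃ j)).mul ((hε j).pow 2))).add
      (((isAlgebraic_nat 2).mul (ha₂ j)).mul (hε j))).add (ha₁ j)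
  have hb₂alg : ∀ j, IsAlgebraic ℚ (b₂ j) := fun j =>
    ((((isAlgebraic_nat 6).mul (ha₄ j)).mul ((hε j).pow 2)).add
      (((isAlgebraic_nat 3).mul (ha₃ j)).mul (hε j))).add (ha₂ j)
  have hb₁alg : ∀ j, IsAlgebraic ℚ (b₁ j) := fun j =>
    ((((isAlgebraic_nat 4).mul (ha₄ j)).mul (hε j)).add (ha₃ j)).mul (hc₃alg j)
  have hb₀alg : ∀ j, IsAlgebraic ℚ (b₀ j) := fun j => (ha₄ j).mul ((hc₃alg j).pow 2)
  -- lattices of the depressed resolvent cubics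
  have hL : ∀ j, ∃ L : PeriodPair, L.g₂ = -4 * ((b₁ j - b₂ j ^ 2 / 3 : ℝ) : ℂ) ∧
      L.g₃ = -4 * ((b₀ j - b₁ j * b₂ j / 3 + 2 * b₂ j ^ 3 / 27 : ℝ) : ℂ) := fun j =>
    stub_quarticLattice (a₄ j) (a₃ j) (a₂ j) (a₁ j) (a₀ j) (ha₄ j) (ha₃ j) (ha₂ j) (ha₁ j) (ha₀ j) (ha₄0 j) (hsep j)
      (ε j) (hroot j)
  choose L hL₂ hL₃ using hL
  -- every cell of the quartic layer is, modulo `M₁`, a cell of the cubic layer for the `D_j`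
  have key : ∀ c : KZ.FormalRep, c ∈ AddSubgroup.closure ((fun r : KZ.IntegralRep 1 => KZ.of r) ''
      {r | r.IsRational ∨ (∃ a b : ℝ, IsAlgebraic ℚ a ∧ IsAlgebraic ℚ b ∧ a < b ∧ r.domain = {z | z 0 ∈ Set.Ioo a b} ∧
            ∃ P : Polynomial (algebraicClosure ℚ ℝ), ∀ x ∈ Set.Ioo a b, r.integrand (fun _ => x) = Polynomial.aeval x P) ∨
        (∃ j, ∃ ε₂ c₀ : ℝ, IsAlgebraic ℚ ε₂ ∧ IsAlgebraic ℚ c₀ ∧ ε j < ε₂ ∧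
          a₄ j * ε₂ ^ 4 + a₃ j * ε₂ ^ 3 + a₂ j * ε₂ ^ 2 + a₁ j * ε₂ + a₀ j = 0 ∧
          (∀ x ∈ Set.Ioo (ε j) ε₂, 0 < a₄ j * x ^ 4 + a₃ j * x ^ 3 + a₂ j * x ^ 2 + a₁ j * x + a₀ j) ∧
          r.domain = {z | z 0 ∈ Set.Ioo (ε j) ε₂} ∧
          ∀ z ∈ r.domain, r.integrand z =
            c₀ / Real.sqrt (a₄ j * (z 0) ^ 4 + a₃ j * (z 0) ^ 3 + a₂ j * (z 0) ^ 2 + a₁ j * (z 0) + a₀ j))}) →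
      ∃ c' : KZ.FormalRep, c' ∈ AddSubgroup.closure ((fun r : KZ.IntegralRep 1 => KZ.of r) ''
      {r | r.IsRational ∨ (∃ a b : ℝ, IsAlgebraic ℚ a ∧ IsAlgebraic ℚ b ∧ a < b ∧ r.domain = {z | z 0 ∈ Set.Ioo a b} ∧
            ∃ P : Polynomial (algebraicClosure ℚ ℝ), ∀ x ∈ Set.Ioo a b, r.integrand (fun _ => x) = Polynomial.aeval x P) ∨
        (∃ j, ∃ ε₁ ε₂ : ℝ, IsAlgebraic ℚ ε₁ ∧ IsAlgebraic ℚ ε₂ ∧ ε₁ < ε₂ ∧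
          ε₁ ^ 3 + b₂ j * ε₁ ^ 2 + b₁ j * ε₁ + b₀ j = 0 ∧ ε₂ ^ 3 + b₂ j * ε₂ ^ 2 + b₁ j * ε₂ + b₀ j = 0 ∧
          (∀ x ∈ Set.Ioo ε₁ ε₂, 0 < x ^ 3 + b₂ j * x ^ 2 + b₁ j * x + b₀ j) ∧ r.domain = {z | z 0 ∈ Set.Ioo ε₁ ε₂} ∧
          ∃ P₁ P₂ P₃ : Polynomial (algebraicClosure ℚ ℝ), ∀ x ∈ Set.Ioo ε₁ ε₂,
            r.integrand (fun _ => x) = Polynomial.aeval x P₁ +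
              Polynomial.aeval x P₂ * Real.sqrt (x ^ 3 + b₂ j * x ^ 2 + b₁ j * x + b₀ j) +
              Polynomial.aeval x P₃ / Real.sqrt (x ^ 3 + b₂ j * x ^ 2 + b₁ j * x + b₀ j)) ∨
        (∃ j, ∃ ε c₀ : ℝ, IsAlgebraic ℚ ε ∧ IsAlgebraic ℚ c₀ ∧ ε ^ 3 + b₂ j * ε ^ 2 + b₁ j * ε + b₀ j = 0 ∧
          (∀ x : ℝ, ε < x → 0 < x ^ 3 + b₂ j * x ^ 2 + b₁ j * x + b₀ j) ∧ r.domain = {z | ε < z 0} ∧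
          ∀ z ∈ r.domain, r.integrand z = c₀ / Real.sqrt ((z 0) ^ 3 + b₂ j * (z 0) ^ 2 + b₁ j * (z 0) + b₀ j))}) ∧
      c - c' ∈ M₁ := by
    intro c hc
    refine AddSubgroup.closure_induction (p := fun c _ => ∃ c' : KZ.FormalRep, c' ∈ _ ∧ c - c' ∈ M₁) ?_ ?_ ?_ ?_ hc
    · rintro _ ⟨r, hr, rfl⟩
      rcases hr with hrat | hpoly | ⟨j, ε₂, c₀, hε₂, hc₀, hlt, hq₂, hpos, hdom, hint⟩
      · exact ⟨KZ.of r, AddSubgroup.subset_closure ⟨r, Or.inl hrat, rfl⟩, by rw [sub_self]; exact M₁.zero_mem⟩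
      · exact ⟨KZ.of r, AddSubgroup.subset_closure ⟨r, Or.inr (Or.inl hpoly), rfl⟩, by rw [sub_self]; exact M₁.zero_mem⟩
      · obtain ⟨ρ, hρdom, hρint, hρroot, hρpos, hrel⟩ := stub_quarticOvalCell (a₄ j) (a₃ j) (a₂ j) (a₁ j) (a₀ j) (ha₄ j)
          (ha₃ j) (ha₂ j) (ha₁ j) (ha₀ j) (ε j) ε₂ c₀ (hε j) hε₂ hc₀ hlt (hroot j) hq₂ hpos (hder j) r hdom hint
        refine ⟨KZ.of ρ, AddSubgroup.subset_closure ⟨ρ, Or.inr (Or.inr (Or.inr ⟨j, c₃ j / (ε₂ - ε j), c₀,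
          (hc₃alg j).mul ((hε₂.sub (hε j)).inv), hc₀, ?_, ?_, hρdom, ?_⟩)), rfl⟩, hrel⟩
        · simpa only [hc₃, hb₂, hb₁, hb₀, div_eq_mul_inv] using hρroot
        · intro x hx
          simpa only [hc₃, hb₂, hb₁, hb₀, div_eq_mul_inv] using hρpos x (by simpa only [hc₃, div_eq_mul_inv] using hx)
        · intro z hz
          simpa only [hc₃, hb₂, hb₁, hb₀] using hρint z hz
    · exact ⟨0, AddSubgroup.zero_mem _, by rw [sub_self]; exact M₁.zero_mem⟩
    · rintro c₁ c₂ _ _ ⟨c₁', h₁', h₁⟩ ⟨c₂', h₂', h₂⟩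
      refine ⟨c₁' + c₂', AddSubgroup.add_mem _ h₁' h₂', ?_⟩
      have e : c₁ + c₂ - (c₁' + c₂') = (c₁ - c₁') + (c₂ - c₂') := by abel
      rw [e]
      exact M₁.add_mem h₁ h₂
    · rintro c₁ _ ⟨c₁', h₁', h₁⟩
      refine ⟨-c₁', AddSubgroup.neg_mem _ h₁', ?_⟩
      have e : -c₁ - -c₁' = -(c₁ - c₁') := by abel
      rw [e]
      exact M₁.neg_mem h₁
  obtain ⟨c', hc', hcc'⟩ := key c hc
  have heval' : KZ.eval c' = 0 := by
    have h := Summit.KontsevichZagierPeriods.SymplecticScissors.RealOnePeriodRelationsNegative.eval_eq_zero_of_mem_M₁ hcc'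
    rw [map_sub, heval, zero_sub, neg_eq_zero] at h
    exact h
  have hM : c' ∈ M₁ :=
    LogLoopLayer.realOnePeriodRelations_ratCubicLayer n b₂ b₁ b₀ hb₂alg hb₁alg hb₀alg L hL₂ hL₃ c' hc' heval'
  have e : c = (c - c') + c' := by abel
  rw [e]
  exact M₁.add_mem hcc' hM

end QuarticLayer

end Summit.KontsevichZagierPeriods.SymplecticScissors.RealOnePeriodRelations

end
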